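import Mathlib
import HarnessLib
import Summits.ValiantsHypothesis.ValiantsHypothesis.Theorems.LacunarySymmetroidMatrixDescartesProductPlusOneFarKneesMerge
import Summits.ValiantsHypothesis.ValiantsHypothesis.Theorems.LacunarySymmetroidMatrixDescartesProductPlusOneLogConvexAlgebra

/-!
# LINE (A) `product_plus_one` (crux `MatrixDescartes`, stmt-ValiantsHypothesis-18050, V1) — W-CB §30.5 C3-(e1), THE LOBE CELL:
# on the binomial tower, the order-6 image of a knee is LOG-CONCAVE INSIDE ITS RING (every support), the image of a pole with
# non-negative image coefficients is LOG-CONVEX, hence «ONE LOBE AGAINST A PURE-POLE BACKGROUND ⇒ the order-6 image `Σ_j Q_{r_j}(ψ₁ʲ)`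
# HAS NO THREE ZEROS in the window» (tower form)

Pen val-idea-25 g6 memo `NOTE-idea25g3-18050-LINEA-AB-reduction.md` §30.5 C3 engine (e1) / §30.7 ask to val-lit-p8 g17; answer in
`pub/val-lit/lmr/NOTE-p8g17-18050-pure-2N-law.md` §11 (closed forms `c₀ = 6(τ−3)(τ−7)r⁴`, `c₁ = 240(7−τ)r²`, `τ = (p²+ps+s²)/r²`).
Currency of ✓ `…SixthOrderRowLaws` (E1) / ✓ `…SixthOrderTower` (E3a): a binomial row of rate `r` has `ψ₂² = r²ψ₁² + 4ψ₁³`, `ψ₃ = r²ψ₁ + 6ψ₁²`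
and order-6 image `P(ψ₁) = c₀ψ₁² + c₁ψ₁³ + 5040ψ₁⁴`; its θ-derivatives are `θP = P′(ψ₁)ψ₂`, `θ²P = P″(ψ₁)ψ₂² + P′(ψ₁)ψ₃`.  §1–§4 are
POINTWISE ALGEBRA in real variables `(ψ, ψ₂, ψ₃)` bound by the two closure laws; §5 is the cell (calculus = ✓ p708429's engine):

* §1 ★ `lobeImage_logConcave_alg` — if `c₀ + c₁ψ + kψ² = k(ψ−ψm)(ψ−ψp)` with `−r²/4 < ψm < ψ < ψp < 0` (ψ INSIDE the ring) then
  `P·θ²P < (θP)²` (the image, negative there, has a strictly log-concave absolute value).  Proof: the identity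
  `(θP)² − P·θ²P = −k²ψ⁵·[4(ψp−ψ)²(ψ−ψm)² + (ψ−ψm)²(2ψ²−6ψpψ−r²ψp) + (ψp−ψ)²(2ψ²−6ψmψ−r²ψm)]` (`ring`) and the two brackets are positive
  (= factor-by-factor log-concavity of `Y²(Y−Y₋)(Y₊−Y)`, `Y = −ψ/r² = ¼sech²`, memo §11.2).
* §2 `lobe_roots` — the ring's roots exist with `−r²/4 < ψm < ψp < 0` as soon as `k, c₀, c₁ > 0`, `4kc₀ < c₁²`, `c₁ < kr²/2`,
  `0 < kr⁴/4 − r²c₁ + 4c₀`; `mem_lobe_of_ring_neg` — `c₀ + c₁ψ + kψ² < 0` puts `ψ` strictly between them.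
* §3 ★ `poleImage_logConvex_alg` — `c₀, c₁, k ≥ 0`, `ψ > 0` ⇒ `(θP)² ≤ P·θ²P`
  (`P·θ²P − (θP)² = ψ⁵·[4c₀² + c₀c₁(14ψ+r²) + c₀k(28ψ²+4r²ψ) + 6c₁²ψ² + c₁k(18ψ³+r²ψ²) + 8k²ψ⁴]`).
* §4 the LINE families (`p = e₁+1`, `s = e₂+1`, coefficients of ✓ E1 verbatim): `midKnee_lobe_conditions` (`0 < p < s`, rate `s`),
  `fastKnee_lobe_conditions` (rate `p+s`) — the §2 conditions hold for EVERY support (`kr⁴/4 − r²c₁ + 4c₀ = 24(p²+ps+s²)² + 84r⁴`);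
  `midPole_coeffs_nonneg`, `fastPole_coeffs_nonneg`; and the packaged ★ `midKnee_lobeImage_logConcave` / ★ `fastKnee_lobeImage_logConcave`
  (ring inequality + closure laws ⇒ `P·θ²P < (θP)²`).
* §5 ★★ `lobe_poleBackground_no_three_zeros` — THE LOBE CELL, tower form: on `(u,v) ⊂ (0,∞)` one knee tower `φ₁,φ₂,φ₃` (closure with rate `r₀`,
  image coefficients satisfying the `lobe_roots` conditions, ring inequality on the window) and a finite family of pole towers `Ψ₁ i > 0` (closure with
  rates `ρ i`, image coefficients `C₀ i, C₁ i ≥ 0`), all with `HasDerivAt φ₁ (φ₂/x)`, `HasDerivAt φ₂ (φ₃/x)` ⇒ the total image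
  `P₀(φ₁) + Σ_i P_i(Ψ₁ i)` does not vanish at three points of the window.  Proof: `A := −P₀(φ₁)` is positive and θ-log-concave (§1), `G := Σ_i P_i(Ψ₁ i)`
  is positive and θ-log-convex (§3 + ✓ `lc_sum`), and ✓ `no_three_zeros_of_logConcave_sub_logConvex` (✓ `…FarKneesMerge`).  The LINE-menu wrapper
  (K12/K02 knee in its ring + P12/P02 poles, `Σ_j Q_{r_j}(ψ₁ʲ) = S₆ − e₁S₄ + e₂S₂ − e₃S₀` by ✓ `sixthOrder_row_value`) is routine plumbing on top.
NOT covered (memo §11.3, honest): the SLOW pole (rate `p`, `s > 2p`) has `c₁ < 0`; its image is positive but its far tail is log-concave when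
`2p < s < 3p`, so it is not a K2 row (at `s = 2p` it is: `c₀ = c₁ = 0`).

HONEST FRAMING: one G-cell (helper) + its algebra; proves nothing about `WronskianBudgetK3` / `OneChangeFloorK3` / the stubs / 18050 /
`MatrixDescartes`; `VP ≠ VNP` is NOT proved.  No definitions, no named facts, no sorry; Mathlib + ✓ lane modules only.
-/

set_option linter.dupNamespace false

namespace Summit.ValiantsHypothesis.ValiantsHypothesis.Theorems.LacunarySymmetroidMatrixDescartes

namespace ProductPlusOne

open Set Finset
open scoped BigOperators

/-! ### §1 Inside the ring the knee image is log-concave -/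

/-- ★ **The lobe image is strictly log-concave** (pointwise, binomial tower of rate `r`): if the ring quadratic factors as
`c₀ + c₁ψ + kψ² = k(ψ−ψm)(ψ−ψp)` (`c₀ = kψmψp`, `c₁ = −k(ψm+ψp)`) with `−r²/4 < ψm < ψ < ψp < 0`, `k ≠ 0`, and the closure laws
`ψ₂² = r²ψ² + 4ψ³`, `ψ₃ = r²ψ + 6ψ²` hold, then `P·θ²P < (θP)²` for `P = c₀ψ² + c₁ψ³ + kψ⁴`. [this file's theorem] -/
theorem lobeImage_logConcave_alg {k r ψm ψp ψ ψ₂ ψ₃ c₀ c₁ : ℝ} (hk : k ≠ 0) (h4 : 0 < r ^ 2 + 4 * ψm)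
    (h1 : ψm < ψ) (h2 : ψ < ψp) (hp : ψp < 0) (hc0 : c₀ = k * (ψm * ψp)) (hc1 : c₁ = -(k * (ψm + ψp)))
    (h2c : ψ₂ ^ 2 = r ^ 2 * ψ ^ 2 + 4 * ψ ^ 3) (h3c : ψ₃ = r ^ 2 * ψ + 6 * ψ ^ 2) :
    (c₀ * ψ ^ 2 + c₁ * ψ ^ 3 + k * ψ ^ 4)
        * ((2 * c₀ + 6 * c₁ * ψ + 12 * k * ψ ^ 2) * ψ₂ ^ 2 + (2 * c₀ * ψ + 3 * c₁ * ψ ^ 2 + 4 * k * ψ ^ 3) * ψ₃)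
      < ((2 * c₀ * ψ + 3 * c₁ * ψ ^ 2 + 4 * k * ψ ^ 3) * ψ₂) ^ 2 := by
  have hψ : ψ < 0 := h2.trans hp
  have hm0 : ψm < 0 := h1.trans hψ
  have hr4 : 0 < r ^ 2 + 4 * ψ := by linarith
  have hGp : 0 < 2 * ψ ^ 2 - 6 * ψp * ψ - r ^ 2 * ψp := by
    nlinarith [mul_pos (neg_pos.2 hp) hr4, mul_pos_of_neg_of_neg hψ (sub_neg.2 h2)]
  have hGm : 0 < 2 * ψ ^ 2 - 6 * ψm * ψ - r ^ 2 * ψm := by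
    nlinarith [mul_pos (neg_pos.2 hm0) h4, mul_pos (sub_pos.2 h1) (show 0 < ψ - 2 * ψm by linarith)]
  have hsq : 0 < (ψp - ψ) ^ 2 * (ψ - ψm) ^ 2 := mul_pos (pow_pos (sub_pos.2 h2) 2) (pow_pos (sub_pos.2 h1) 2)
  have key : ((2 * c₀ * ψ + 3 * c₁ * ψ ^ 2 + 4 * k * ψ ^ 3) * ψ₂) ^ 2
      - (c₀ * ψ ^ 2 + c₁ * ψ ^ 3 + k * ψ ^ 4)
        * ((2 * c₀ + 6 * c₁ * ψ + 12 * k * ψ ^ 2) * ψ₂ ^ 2 + (2 * c₀ * ψ + 3 * c₁ * ψ ^ 2 + 4 * k * ψ ^ 3) * ψ₃)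
      = (-(k ^ 2 * ψ ^ 5)) * (4 * ((ψp - ψ) ^ 2 * (ψ - ψm) ^ 2)
          + (ψ - ψm) ^ 2 * (2 * ψ ^ 2 - 6 * ψp * ψ - r ^ 2 * ψp) + (ψp - ψ) ^ 2 * (2 * ψ ^ 2 - 6 * ψm * ψ - r ^ 2 * ψm)) := by
    rw [mul_pow, h2c, h3c, hc0, hc1]; ring
  have h5 : ψ ^ 5 < 0 := Odd.pow_neg ⟨2, by norm_num⟩ hψ
  have hk2 : 0 < k ^ 2 := by positivity
  have hneg : 0 < -(k ^ 2 * ψ ^ 5) := by nlinarith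
  have hpos : 0 < ((2 * c₀ * ψ + 3 * c₁ * ψ ^ 2 + 4 * k * ψ ^ 3) * ψ₂) ^ 2
      - (c₀ * ψ ^ 2 + c₁ * ψ ^ 3 + k * ψ ^ 4)
        * ((2 * c₀ + 6 * c₁ * ψ + 12 * k * ψ ^ 2) * ψ₂ ^ 2 + (2 * c₀ * ψ + 3 * c₁ * ψ ^ 2 + 4 * k * ψ ^ 3) * ψ₃) := by
    rw [key]
    refine mul_pos hneg ?_
    have h2' : 0 ≤ (ψ - ψm) ^ 2 * (2 * ψ ^ 2 - 6 * ψp * ψ - r ^ 2 * ψp) := mul_nonneg (sq_nonneg _) hGp.le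
    have h3' : 0 ≤ (ψp - ψ) ^ 2 * (2 * ψ ^ 2 - 6 * ψm * ψ - r ^ 2 * ψm) := mul_nonneg (sq_nonneg _) hGm.le
    linarith
  linarith

/-! ### §2 The ring's roots -/

/-- **The ring quadratic has two roots `−r²/4 < ψm < ψp < 0`** when `k, c₀, c₁ > 0`, `4kc₀ < c₁²`, `c₁ < kr²/2` and `0 < kr⁴/4 − r²c₁ + 4c₀`
(quadratic formula; the last two conditions say `−r²/4` lies left of both roots). [folklore] -/
theorem lobe_roots {k r c₀ c₁ : ℝ} (hk : 0 < k) (hc0 : 0 < c₀) (hc1 : 0 < c₁) (hD : 4 * k * c₀ < c₁ ^ 2)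
    (hc1' : c₁ < k * r ^ 2 / 2) (hq : 0 < k * r ^ 4 / 4 - r ^ 2 * c₁ + 4 * c₀) :
    ∃ ψm ψp : ℝ, 0 < r ^ 2 + 4 * ψm ∧ ψm < ψp ∧ ψp < 0 ∧ c₀ = k * (ψm * ψp) ∧ c₁ = -(k * (ψm + ψp)) := by
  obtain ⟨σ, hσ0, hσσ⟩ : ∃ σ : ℝ, 0 < σ ∧ σ * σ = c₁ ^ 2 - 4 * k * c₀ :=
    ⟨Real.sqrt (c₁ ^ 2 - 4 * k * c₀), Real.sqrt_pos.2 (by linarith), Real.mul_self_sqrt (by linarith)⟩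
  have hk2 : 0 < 2 * k := by linarith
  refine ⟨(-c₁ - σ) / (2 * k), (-c₁ + σ) / (2 * k), ?_, ?_, ?_, ?_, ?_⟩
  · -- `σ < kr²/2 − c₁`, from `σ² < (kr²/2 − c₁)²` and positivity of the right-hand side
    have hR : 0 < k * r ^ 2 / 2 - c₁ := by linarith
    have hσlt : σ < k * r ^ 2 / 2 - c₁ := by
      have h' : σ * σ < (k * r ^ 2 / 2 - c₁) * (k * r ^ 2 / 2 - c₁) := by rw [hσσ]; nlinarith
      by_contra hle
      push Not at hle
      nlinarith [mul_le_mul hle hle hR.le (hR.le.trans hle)]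
    have : 0 < k * r ^ 2 - 2 * c₁ - 2 * σ := by linarith
    have hex : r ^ 2 + 4 * ((-c₁ - σ) / (2 * k)) = (k * r ^ 2 - 2 * c₁ - 2 * σ) / k := by field_simp; ring
    rw [hex]; exact div_pos this hk
  · exact div_lt_div_of_pos_right (by linarith) hk2
  · -- `σ < c₁` from `σ² < c₁²`
    have hσlt : σ < c₁ := by
      by_contra hle
      push Not at hle
      nlinarith [mul_le_mul hle hle hc1.le (hc1.le.trans hle)]
    exact div_neg_of_neg_of_pos (by linarith) hk2
  · field_simp
    linear_combination hσσ
  · field_simp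
    ring

/-- **Inside the ring means between the roots**: `k(ψ−ψm)(ψ−ψp) < 0` with `k > 0`, `ψm < ψp` ⇒ `ψm < ψ < ψp`. [folklore] -/
theorem mem_lobe_of_ring_neg {k ψm ψp ψ c₀ c₁ : ℝ} (hk : 0 < k) (hmp : ψm < ψp) (hc0 : c₀ = k * (ψm * ψp))
    (hc1 : c₁ = -(k * (ψm + ψp))) (hring : c₀ + c₁ * ψ + k * ψ ^ 2 < 0) : ψm < ψ ∧ ψ < ψp := by
  have hprod : (ψ - ψm) * (ψ - ψp) < 0 := by
    have : c₀ + c₁ * ψ + k * ψ ^ 2 = k * ((ψ - ψm) * (ψ - ψp)) := by rw [hc0, hc1]; ring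
    rw [this] at hring
    exact (mul_neg_iff.1 hring).elim (fun h => h.2) (fun h => absurd hk (not_lt.2 h.1.le))
  rcases mul_neg_iff.1 hprod with ⟨ha, hb⟩ | ⟨ha, hb⟩
  · exact ⟨by linarith, by linarith⟩
  · exfalso; linarith

/-! ### §3 A pole image with non-negative image coefficients is log-convex -/

/-- ★ **Pole images are log-convex** (pointwise, binomial tower of rate `r`): `c₀, c₁, k ≥ 0`, `ψ > 0` and the closure laws ⇒ `(θP)² ≤ P·θ²P`
for `P = c₀ψ² + c₁ψ³ + kψ⁴` — each `ψ^j` is θ-log-convex (`(log ψ^j)'' = 2jψ > 0` in `u = log x`) and so is a non-negative combination.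
[this file's theorem] -/
theorem poleImage_logConvex_alg {k r ψ ψ₂ ψ₃ c₀ c₁ : ℝ} (hc0 : 0 ≤ c₀) (hc1 : 0 ≤ c₁) (hk : 0 ≤ k) (hψ : 0 < ψ)
    (h2c : ψ₂ ^ 2 = r ^ 2 * ψ ^ 2 + 4 * ψ ^ 3) (h3c : ψ₃ = r ^ 2 * ψ + 6 * ψ ^ 2) :
    ((2 * c₀ * ψ + 3 * c₁ * ψ ^ 2 + 4 * k * ψ ^ 3) * ψ₂) ^ 2
      ≤ (c₀ * ψ ^ 2 + c₁ * ψ ^ 3 + k * ψ ^ 4)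
        * ((2 * c₀ + 6 * c₁ * ψ + 12 * k * ψ ^ 2) * ψ₂ ^ 2 + (2 * c₀ * ψ + 3 * c₁ * ψ ^ 2 + 4 * k * ψ ^ 3) * ψ₃) := by
  have key : (c₀ * ψ ^ 2 + c₁ * ψ ^ 3 + k * ψ ^ 4)
        * ((2 * c₀ + 6 * c₁ * ψ + 12 * k * ψ ^ 2) * ψ₂ ^ 2 + (2 * c₀ * ψ + 3 * c₁ * ψ ^ 2 + 4 * k * ψ ^ 3) * ψ₃)
      - ((2 * c₀ * ψ + 3 * c₁ * ψ ^ 2 + 4 * k * ψ ^ 3) * ψ₂) ^ 2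
      = ψ ^ 5 * (4 * c₀ ^ 2 + c₀ * c₁ * (14 * ψ + r ^ 2) + c₀ * k * (28 * ψ ^ 2 + 4 * r ^ 2 * ψ) + 6 * c₁ ^ 2 * ψ ^ 2
          + c₁ * k * (18 * ψ ^ 3 + r ^ 2 * ψ ^ 2) + 8 * k ^ 2 * ψ ^ 4) := by
    rw [mul_pow, h2c, h3c]; ring
  have : 0 ≤ ψ ^ 5 * (4 * c₀ ^ 2 + c₀ * c₁ * (14 * ψ + r ^ 2) + c₀ * k * (28 * ψ ^ 2 + 4 * r ^ 2 * ψ) + 6 * c₁ ^ 2 * ψ ^ 2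
          + c₁ * k * (18 * ψ ^ 3 + r ^ 2 * ψ ^ 2) + 8 * k ^ 2 * ψ ^ 4) := by positivity
  linarith

/-! ### §4 The LINE families: middle-rate and fast knees (lobes), middle-rate and fast poles -/

section Families

variable {p s : ℝ}

/-- **Middle-rate knee** (`0 < p < s`, rate `s`, `c₀(s) = 6(s−p)(2s−p)(2s+p)(3s+p)`, `c₁(s) = 240(3s+p)(2s−p)`): the six conditions of
`lobe_roots` hold — `c₁² − 20160c₀ = 240(3s+p)(2s−p)(432s²+264ps+264p²)`, `1260s⁴ − s²c₁ + 4c₀ = 24(p²+ps+s²)² + 84s⁴`. [this file's lemma] -/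
theorem midKnee_lobe_conditions (hp : 0 < p) (hps : p < s) :
    0 < 6 * ((s - p) * (2 * s - p) * (2 * s + p) * (3 * s + p)) ∧ 0 < 240 * ((3 * s + p) * (2 * s - p)) ∧
      4 * 5040 * (6 * ((s - p) * (2 * s - p) * (2 * s + p) * (3 * s + p))) < (240 * ((3 * s + p) * (2 * s - p))) ^ 2 ∧
      240 * ((3 * s + p) * (2 * s - p)) < 5040 * s ^ 2 / 2 ∧
      0 < 5040 * s ^ 4 / 4 - s ^ 2 * (240 * ((3 * s + p) * (2 * s - p))) + 4 * (6 * ((s - p) * (2 * s - p) * (2 * s + p) * (3 * s + p))) := by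
  have h1 : 0 < s - p := by linarith
  have h2 : 0 < 2 * s - p := by linarith
  have h3 : 0 < 2 * s + p := by linarith
  have h4 : 0 < 3 * s + p := by linarith
  have hs : 0 < s := by linarith
  refine ⟨by positivity, by positivity, ?_, by nlinarith [mul_pos hp hs], ?_⟩
  · have : (240 * ((3 * s + p) * (2 * s - p))) ^ 2 - 4 * 5040 * (6 * ((s - p) * (2 * s - p) * (2 * s + p) * (3 * s + p)))
        = 240 * ((3 * s + p) * (2 * s - p)) * (432 * s ^ 2 + 264 * p * s + 264 * p ^ 2) := by ring
    have hpos : 0 < 240 * ((3 * s + p) * (2 * s - p)) * (432 * s ^ 2 + 264 * p * s + 264 * p ^ 2) := by positivity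
    linarith
  · have : 5040 * s ^ 4 / 4 - s ^ 2 * (240 * ((3 * s + p) * (2 * s - p))) + 4 * (6 * ((s - p) * (2 * s - p) * (2 * s + p) * (3 * s + p)))
        = 24 * (p ^ 2 + p * s + s ^ 2) ^ 2 + 84 * s ^ 4 := by ring
    rw [this]; positivity

/-- **Fast knee** (`0 < p, s`, rate `p+s`, `c₀(q) = 6(12p⁴+56p³s+89p²s²+56ps³+12s⁴)`, `c₁(q) = 120(12p²+26ps+12s²)`): the conditions of
`lobe_roots` hold (`1260(p+s)⁴ − (p+s)²c₁ + 4c₀ = 24(p²+ps+s²)² + 84(p+s)⁴`). [this file's lemma] -/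
theorem fastKnee_lobe_conditions (hp : 0 < p) (hs : 0 < s) :
    0 < 6 * (12 * p ^ 4 + 56 * p ^ 3 * s + 89 * p ^ 2 * s ^ 2 + 56 * p * s ^ 3 + 12 * s ^ 4) ∧
      0 < 120 * (12 * p ^ 2 + 26 * p * s + 12 * s ^ 2) ∧
      4 * 5040 * (6 * (12 * p ^ 4 + 56 * p ^ 3 * s + 89 * p ^ 2 * s ^ 2 + 56 * p * s ^ 3 + 12 * s ^ 4))
        < (120 * (12 * p ^ 2 + 26 * p * s + 12 * s ^ 2)) ^ 2 ∧
      120 * (12 * p ^ 2 + 26 * p * s + 12 * s ^ 2) < 5040 * (p + s) ^ 2 / 2 ∧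
      0 < 5040 * (p + s) ^ 4 / 4 - (p + s) ^ 2 * (120 * (12 * p ^ 2 + 26 * p * s + 12 * s ^ 2))
        + 4 * (6 * (12 * p ^ 4 + 56 * p ^ 3 * s + 89 * p ^ 2 * s ^ 2 + 56 * p * s ^ 3 + 12 * s ^ 4)) := by
  refine ⟨by positivity, by positivity, ?_, by nlinarith [mul_pos hp hs], ?_⟩
  · have : (120 * (12 * p ^ 2 + 26 * p * s + 12 * s ^ 2)) ^ 2
          - 4 * 5040 * (6 * (12 * p ^ 4 + 56 * p ^ 3 * s + 89 * p ^ 2 * s ^ 2 + 56 * p * s ^ 3 + 12 * s ^ 4))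
        = 622080 * p ^ 4 + 2211840 * p ^ 3 * s + 3116160 * p ^ 2 * s ^ 2 + 2211840 * p * s ^ 3 + 622080 * s ^ 4 := by ring
    have hpos : 0 < 622080 * p ^ 4 + 2211840 * p ^ 3 * s + 3116160 * p ^ 2 * s ^ 2 + 2211840 * p * s ^ 3 + 622080 * s ^ 4 := by
      positivity
    linarith
  · have : 5040 * (p + s) ^ 4 / 4 - (p + s) ^ 2 * (120 * (12 * p ^ 2 + 26 * p * s + 12 * s ^ 2))
          + 4 * (6 * (12 * p ^ 4 + 56 * p ^ 3 * s + 89 * p ^ 2 * s ^ 2 + 56 * p * s ^ 3 + 12 * s ^ 4))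
        = 24 * (p ^ 2 + p * s + s ^ 2) ^ 2 + 84 * (p + s) ^ 4 := by ring
    rw [this]; positivity

/-- **Middle-rate pole** (`0 ≤ p ≤ s`): its image coefficients `c₀(s), c₁(s)` are non-negative (a K2 row). [this file's lemma] -/
theorem midPole_coeffs_nonneg (hp : 0 ≤ p) (hps : p ≤ s) :
    0 ≤ 6 * ((s - p) * (2 * s - p) * (2 * s + p) * (3 * s + p)) ∧ 0 ≤ 240 * ((3 * s + p) * (2 * s - p)) := by
  have h1 : 0 ≤ s - p := by linarith
  have h2 : 0 ≤ 2 * s - p := by linarith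
  have h3 : 0 ≤ 2 * s + p := by linarith
  have h4 : 0 ≤ 3 * s + p := by linarith
  exact ⟨by positivity, by positivity⟩

/-- **Fast pole** (`0 ≤ p, s`): its image coefficients `c₀(q), c₁(q)` are non-negative (a K2 row). [this file's lemma] -/
theorem fastPole_coeffs_nonneg (hp : 0 ≤ p) (hs : 0 ≤ s) :
    0 ≤ 6 * (12 * p ^ 4 + 56 * p ^ 3 * s + 89 * p ^ 2 * s ^ 2 + 56 * p * s ^ 3 + 12 * s ^ 4) ∧
      0 ≤ 120 * (12 * p ^ 2 + 26 * p * s + 12 * s ^ 2) :=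
  ⟨by positivity, by positivity⟩

/-- ★ **Middle-rate knee, inside its ring: the image is log-concave** — `0 < p < s`, `c₀(s) + c₁(s)ψ + 5040ψ² < 0`, closure laws with rate
`s` ⇒ `P·θ²P < (θP)²`. [this file's theorem] -/
theorem midKnee_lobeImage_logConcave (hp : 0 < p) (hps : p < s) {ψ ψ₂ ψ₃ : ℝ}
    (hring : 6 * ((s - p) * (2 * s - p) * (2 * s + p) * (3 * s + p)) + 240 * ((3 * s + p) * (2 * s - p)) * ψ + 5040 * ψ ^ 2 < 0)
    (h2c : ψ₂ ^ 2 = s ^ 2 * ψ ^ 2 + 4 * ψ ^ 3) (h3c : ψ₃ = s ^ 2 * ψ + 6 * ψ ^ 2) :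
    (6 * ((s - p) * (2 * s - p) * (2 * s + p) * (3 * s + p)) * ψ ^ 2 + 240 * ((3 * s + p) * (2 * s - p)) * ψ ^ 3 + 5040 * ψ ^ 4)
        * ((2 * (6 * ((s - p) * (2 * s - p) * (2 * s + p) * (3 * s + p))) + 6 * (240 * ((3 * s + p) * (2 * s - p))) * ψ
              + 12 * 5040 * ψ ^ 2) * ψ₂ ^ 2
          + (2 * (6 * ((s - p) * (2 * s - p) * (2 * s + p) * (3 * s + p))) * ψ + 3 * (240 * ((3 * s + p) * (2 * s - p))) * ψ ^ 2
              + 4 * 5040 * ψ ^ 3) * ψ₃)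
      < ((2 * (6 * ((s - p) * (2 * s - p) * (2 * s + p) * (3 * s + p))) * ψ + 3 * (240 * ((3 * s + p) * (2 * s - p))) * ψ ^ 2
          + 4 * 5040 * ψ ^ 3) * ψ₂) ^ 2 := by
  obtain ⟨hc0, hc1, hD, hc1', hq⟩ := midKnee_lobe_conditions hp hps
  obtain ⟨ψm, ψp, h4, hmp, hp0, hv0, hv1⟩ := lobe_roots (r := s) (by norm_num : (0 : ℝ) < 5040) hc0 hc1 hD hc1' hq
  obtain ⟨h1, h2⟩ := mem_lobe_of_ring_neg (by norm_num : (0 : ℝ) < 5040) hmp hv0 hv1 hring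
  exact lobeImage_logConcave_alg (by norm_num : (5040 : ℝ) ≠ 0) h4 h1 h2 hp0 hv0 hv1 h2c h3c

/-- ★ **Fast knee, inside its ring: the image is log-concave** — `0 < p, s`, `c₀(q) + c₁(q)ψ + 5040ψ² < 0`, closure laws with rate `p+s`
⇒ `P·θ²P < (θP)²`. [this file's theorem] -/
theorem fastKnee_lobeImage_logConcave (hp : 0 < p) (hs : 0 < s) {ψ ψ₂ ψ₃ : ℝ}
    (hring : 6 * (12 * p ^ 4 + 56 * p ^ 3 * s + 89 * p ^ 2 * s ^ 2 + 56 * p * s ^ 3 + 12 * s ^ 4)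
      + 120 * (12 * p ^ 2 + 26 * p * s + 12 * s ^ 2) * ψ + 5040 * ψ ^ 2 < 0)
    (h2c : ψ₂ ^ 2 = (p + s) ^ 2 * ψ ^ 2 + 4 * ψ ^ 3) (h3c : ψ₃ = (p + s) ^ 2 * ψ + 6 * ψ ^ 2) :
    (6 * (12 * p ^ 4 + 56 * p ^ 3 * s + 89 * p ^ 2 * s ^ 2 + 56 * p * s ^ 3 + 12 * s ^ 4) * ψ ^ 2
          + 120 * (12 * p ^ 2 + 26 * p * s + 12 * s ^ 2) * ψ ^ 3 + 5040 * ψ ^ 4)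
        * ((2 * (6 * (12 * p ^ 4 + 56 * p ^ 3 * s + 89 * p ^ 2 * s ^ 2 + 56 * p * s ^ 3 + 12 * s ^ 4))
              + 6 * (120 * (12 * p ^ 2 + 26 * p * s + 12 * s ^ 2)) * ψ + 12 * 5040 * ψ ^ 2) * ψ₂ ^ 2
          + (2 * (6 * (12 * p ^ 4 + 56 * p ^ 3 * s + 89 * p ^ 2 * s ^ 2 + 56 * p * s ^ 3 + 12 * s ^ 4)) * ψ
              + 3 * (120 * (12 * p ^ 2 + 26 * p * s + 12 * s ^ 2)) * ψ ^ 2 + 4 * 5040 * ψ ^ 3) * ψ₃)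
      < ((2 * (6 * (12 * p ^ 4 + 56 * p ^ 3 * s + 89 * p ^ 2 * s ^ 2 + 56 * p * s ^ 3 + 12 * s ^ 4)) * ψ
          + 3 * (120 * (12 * p ^ 2 + 26 * p * s + 12 * s ^ 2)) * ψ ^ 2 + 4 * 5040 * ψ ^ 3) * ψ₂) ^ 2 := by
  obtain ⟨hc0, hc1, hD, hc1', hq⟩ := fastKnee_lobe_conditions hp hs
  obtain ⟨ψm, ψp, h4, hmp, hp0, hv0, hv1⟩ := lobe_roots (r := p + s) (by norm_num : (0 : ℝ) < 5040) hc0 hc1 hD hc1' hq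
  obtain ⟨h1, h2⟩ := mem_lobe_of_ring_neg (by norm_num : (0 : ℝ) < 5040) hmp hv0 hv1 hring
  exact lobeImage_logConcave_alg (by norm_num : (5040 : ℝ) ≠ 0) h4 h1 h2 hp0 hv0 hv1 h2c h3c

end Families

/-! ### §5 The lobe cell (tower form) -/

/-- ★★ **THE LOBE CELL (tower form): one knee inside its ring against a pure-pole background ⇒ the order-6 image has no three zeros.**
Window `(u,v)`, `0 ≤ u`.  Knee tower `φ₁, φ₂, φ₃` with `θφ₁ = φ₂`, `θφ₂ = φ₃`, closure laws of rate `r₀`, image coefficients `c₀, c₁` (with `k > 0`)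
satisfying the conditions of `lobe_roots`, and the ring inequality `c₀ + c₁φ₁ + kφ₁² < 0` on the window; pole towers `Ψ₁ i, Ψ₂ i, Ψ₃ i` (`i ∈ s`) with
`Ψ₁ i > 0`, closure laws of rates `ρ i`, image coefficients `C₀ i, C₁ i ≥ 0`.  Then `P₀(φ₁) + Σ_{i∈s} P_i(Ψ₁ i)` (`P(ψ) = c₀ψ² + c₁ψ³ + kψ⁴`) does not
vanish at three points `x₁ < x₂ < x₃` of the window. [this file's theorem] -/
theorem lobe_poleBackground_no_three_zeros {k r₀ c₀ c₁ : ℝ} {φ₁ φ₂ φ₃ : ℝ → ℝ} {u v : ℝ} (hu : 0 ≤ u) (hk : 0 < k)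
    (hc0 : 0 < c₀) (hc1 : 0 < c₁) (hD : 4 * k * c₀ < c₁ ^ 2) (hc1' : c₁ < k * r₀ ^ 2 / 2) (hq : 0 < k * r₀ ^ 4 / 4 - r₀ ^ 2 * c₁ + 4 * c₀)
    (hφ₁ : ∀ x ∈ Ioo u v, HasDerivAt φ₁ (φ₂ x / x) x) (hφ₂ : ∀ x ∈ Ioo u v, HasDerivAt φ₂ (φ₃ x / x) x)
    (hφc : ∀ x ∈ Ioo u v, φ₂ x ^ 2 = r₀ ^ 2 * φ₁ x ^ 2 + 4 * φ₁ x ^ 3 ∧ φ₃ x = r₀ ^ 2 * φ₁ x + 6 * φ₁ x ^ 2)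
    (hring : ∀ x ∈ Ioo u v, c₀ + c₁ * φ₁ x + k * φ₁ x ^ 2 < 0)
    {ι : Type*} (s : Finset ι) (Ψ₁ Ψ₂ Ψ₃ : ι → ℝ → ℝ) (ρ C₀ C₁ : ι → ℝ) (hC : ∀ i ∈ s, 0 ≤ C₀ i ∧ 0 ≤ C₁ i)
    (hΨpos : ∀ x ∈ Ioo u v, ∀ i ∈ s, 0 < Ψ₁ i x)
    (hΨ₁ : ∀ x ∈ Ioo u v, ∀ i ∈ s, HasDerivAt (Ψ₁ i) (Ψ₂ i x / x) x) (hΨ₂ : ∀ x ∈ Ioo u v, ∀ i ∈ s, HasDerivAt (Ψ₂ i) (Ψ₃ i x / x) x)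
    (hΨc : ∀ x ∈ Ioo u v, ∀ i ∈ s, Ψ₂ i x ^ 2 = ρ i ^ 2 * Ψ₁ i x ^ 2 + 4 * Ψ₁ i x ^ 3 ∧ Ψ₃ i x = ρ i ^ 2 * Ψ₁ i x + 6 * Ψ₁ i x ^ 2)
    {x₁ x₂ x₃ : ℝ} (h₁ : x₁ ∈ Ioo u v) (h₃ : x₃ ∈ Ioo u v) (h12 : x₁ < x₂) (h23 : x₂ < x₃)
    (hzero : ∀ x ∈ ({x₁, x₂, x₃} : Set ℝ),
      (c₀ * φ₁ x ^ 2 + c₁ * φ₁ x ^ 3 + k * φ₁ x ^ 4) + ∑ i ∈ s, (C₀ i * Ψ₁ i x ^ 2 + C₁ i * Ψ₁ i x ^ 3 + k * Ψ₁ i x ^ 4) = 0) :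
    False := by
  have hx0 : ∀ x ∈ Ioo u v, (x : ℝ) ≠ 0 := fun x hx => (hu.trans_lt hx.1).ne'
  have h₂ : x₂ ∈ Ioo u v := ⟨h₁.1.trans h12, h23.trans h₃.2⟩
  -- the knee side: `A = −P₀(φ₁)` and its θ-tower
  set A : ℝ → ℝ := fun x => -(c₀ * φ₁ x ^ 2 + c₁ * φ₁ x ^ 3 + k * φ₁ x ^ 4) with hAdef
  set A₁ : ℝ → ℝ := fun x => -((2 * c₀ * φ₁ x + 3 * c₁ * φ₁ x ^ 2 + 4 * k * φ₁ x ^ 3) * φ₂ x) with hA₁def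
  set A₂ : ℝ → ℝ := fun x => -((2 * c₀ + 6 * c₁ * φ₁ x + 12 * k * φ₁ x ^ 2) * φ₂ x ^ 2
      + (2 * c₀ * φ₁ x + 3 * c₁ * φ₁ x ^ 2 + 4 * k * φ₁ x ^ 3) * φ₃ x) with hA₂def
  have hA : ∀ x ∈ Ioo u v, HasDerivAt A (A₁ x / x) x := by
    intro x hx
    have h1 := hφ₁ x hx
    have h := (((h1.pow 2).const_mul c₀).add ((h1.pow 3).const_mul c₁)).add ((h1.pow 4).const_mul k)
    refine (h.neg).congr_deriv ?_
    simp only [hA₁def, Nat.cast_ofNat]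
    field_simp
    ring
  have hA' : ∀ x ∈ Ioo u v, HasDerivAt A₁ (A₂ x / x) x := by
    intro x hx
    have h1 := hφ₁ x hx
    have h2 := hφ₂ x hx
    have hpoly : HasDerivAt (fun t => 2 * c₀ * φ₁ t + 3 * c₁ * φ₁ t ^ 2 + 4 * k * φ₁ t ^ 3)
        (2 * c₀ * (φ₂ x / x) + 3 * c₁ * (2 * φ₁ x ^ 1 * (φ₂ x / x)) + 4 * k * (3 * φ₁ x ^ 2 * (φ₂ x / x))) x := by
      have h := ((h1.const_mul (2 * c₀)).add ((h1.pow 2).const_mul (3 * c₁))).add ((h1.pow 3).const_mul (4 * k))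
      refine h.congr_deriv ?_
      simp only [Nat.cast_ofNat]
    have h := (hpoly.mul h2).neg
    refine h.congr_deriv ?_
    simp only [hA₂def]
    field_simp
    ring
  -- the pole side: `G = Σ P_i(Ψ₁ i)` and its θ-tower
  set G : ℝ → ℝ := fun x => ∑ i ∈ s, (C₀ i * Ψ₁ i x ^ 2 + C₁ i * Ψ₁ i x ^ 3 + k * Ψ₁ i x ^ 4) with hGdef
  set G₁ : ℝ → ℝ := fun x => ∑ i ∈ s, (2 * C₀ i * Ψ₁ i x + 3 * C₁ i * Ψ₁ i x ^ 2 + 4 * k * Ψ₁ i x ^ 3) * Ψ₂ i x with hG₁def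
  set G₂ : ℝ → ℝ := fun x => ∑ i ∈ s, ((2 * C₀ i + 6 * C₁ i * Ψ₁ i x + 12 * k * Ψ₁ i x ^ 2) * Ψ₂ i x ^ 2
      + (2 * C₀ i * Ψ₁ i x + 3 * C₁ i * Ψ₁ i x ^ 2 + 4 * k * Ψ₁ i x ^ 3) * Ψ₃ i x) with hG₂def
  have hG : ∀ x ∈ Ioo u v, HasDerivAt G (G₁ x / x) x := by
    intro x hx
    have h := HasDerivAt.fun_sum (u := s) (fun i hi =>
      ((((hΨ₁ x hx i hi).pow 2).const_mul (C₀ i)).add (((hΨ₁ x hx i hi).pow 3).const_mul (C₁ i))).add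
        (((hΨ₁ x hx i hi).pow 4).const_mul k))
    refine h.congr_deriv ?_
    rw [hG₁def, Finset.sum_div]
    refine Finset.sum_congr rfl fun i _ => ?_
    simp only [Nat.cast_ofNat]
    field_simp
    ring
  have hG' : ∀ x ∈ Ioo u v, HasDerivAt G₁ (G₂ x / x) x := by
    intro x hx
    have h := HasDerivAt.fun_sum (u := s) (fun i hi => by
      have h1 := hΨ₁ x hx i hi
      have hpoly : HasDerivAt (fun t => 2 * C₀ i * Ψ₁ i t + 3 * C₁ i * Ψ₁ i t ^ 2 + 4 * k * Ψ₁ i t ^ 3)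
          (2 * C₀ i * (Ψ₂ i x / x) + 3 * C₁ i * (2 * Ψ₁ i x ^ 1 * (Ψ₂ i x / x)) + 4 * k * (3 * Ψ₁ i x ^ 2 * (Ψ₂ i x / x))) x := by
        have h := ((h1.const_mul (2 * C₀ i)).add ((h1.pow 2).const_mul (3 * C₁ i))).add ((h1.pow 3).const_mul (4 * k))
        refine h.congr_deriv ?_
        simp only [Nat.cast_ofNat]
      exact hpoly.mul (hΨ₂ x hx i hi))
    refine h.congr_deriv ?_
    rw [hG₂def, Finset.sum_div]
    refine Finset.sum_congr rfl fun i _ => ?_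
    field_simp
    ring
  -- signs and curvature on the window
  have hφne : ∀ x ∈ Ioo u v, φ₁ x ≠ 0 := by
    intro x hx h
    have := hring x hx
    rw [h] at this
    nlinarith
  have hApos : ∀ x ∈ Ioo u v, 0 < A x := by
    intro x hx
    have hsq : 0 < φ₁ x ^ 2 := by
      rcases lt_or_gt_of_ne (hφne x hx) with h | h
      · nlinarith
      · positivity
    have : A x = φ₁ x ^ 2 * (-(c₀ + c₁ * φ₁ x + k * φ₁ x ^ 2)) := by simp only [hAdef]; ring
    rw [this]
    exact mul_pos hsq (by linarith [hring x hx])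
  have hlc : ∀ x ∈ Ioo u v, A x * A₂ x < A₁ x ^ 2 := by
    intro x hx
    obtain ⟨ψm, ψp, h4, hmp, hp0, hv0, hv1⟩ := lobe_roots hk hc0 hc1 hD hc1' hq
    obtain ⟨hl1, hl2⟩ := mem_lobe_of_ring_neg hk hmp hv0 hv1 (hring x hx)
    have h := lobeImage_logConcave_alg hk.ne' h4 hl1 hl2 hp0 hv0 hv1 (hφc x hx).1 (hφc x hx).2
    have e1 : A x * A₂ x = (c₀ * φ₁ x ^ 2 + c₁ * φ₁ x ^ 3 + k * φ₁ x ^ 4)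
        * ((2 * c₀ + 6 * c₁ * φ₁ x + 12 * k * φ₁ x ^ 2) * φ₂ x ^ 2
          + (2 * c₀ * φ₁ x + 3 * c₁ * φ₁ x ^ 2 + 4 * k * φ₁ x ^ 3) * φ₃ x) := by
      simp only [hAdef, hA₂def]; ring
    have e2 : A₁ x ^ 2 = ((2 * c₀ * φ₁ x + 3 * c₁ * φ₁ x ^ 2 + 4 * k * φ₁ x ^ 3) * φ₂ x) ^ 2 := by
      simp only [hA₁def]; ring
    rw [e1, e2]; exact h
  have hterm : ∀ x ∈ Ioo u v, ∀ i ∈ s, 0 < C₀ i * Ψ₁ i x ^ 2 + C₁ i * Ψ₁ i x ^ 3 + k * Ψ₁ i x ^ 4 := by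
    intro x hx i hi
    have hψ := hΨpos x hx i hi
    have h0 : 0 ≤ C₀ i * Ψ₁ i x ^ 2 + C₁ i * Ψ₁ i x ^ 3 := by
      have := (hC i hi).1; have := (hC i hi).2; positivity
    have : 0 < k * Ψ₁ i x ^ 4 := by positivity
    linarith
  have hlx : ∀ x ∈ Ioo u v, G₁ x ^ 2 ≤ G x * G₂ x := by
    intro x hx
    simp only [hGdef, hG₁def, hG₂def]
    refine lc_sum s _ _ _ (fun i hi => (hterm x hx i hi).le) (fun i hi => ?_) (fun i hi => ?_)
    · have hψ := hΨpos x hx i hi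
      have := (hC i hi).1; have := (hC i hi).2
      have h3 : 0 ≤ Ψ₃ i x := by rw [(hΨc x hx i hi).2]; positivity
      positivity
    · exact poleImage_logConvex_alg (hC i hi).1 (hC i hi).2 hk.le (hΨpos x hx i hi) (hΨc x hx i hi).1 (hΨc x hx i hi).2
  -- the zeros: `A = G` at the three points
  have hz : ∀ x ∈ ({x₁, x₂, x₃} : Set ℝ), A x = G x := by
    intro x hx
    have h := hzero x hx
    simp only [hAdef, hGdef]
    linarith
  rcases s.eq_empty_or_nonempty with hs | hs
  · -- no pole: `A(x₁) = 0`, contradicting `A > 0`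
    have h := hz x₁ (by simp)
    have hG0 : G x₁ = 0 := by simp only [hGdef, hs, Finset.sum_empty]
    rw [hG0] at h
    exact absurd h (hApos x₁ h₁).ne'
  · have hGpos : ∀ x ∈ Ioo u v, 0 < G x := fun x hx => by
      simp only [hGdef]; exact Finset.sum_pos (fun i hi => hterm x hx i hi) hs
    exact no_three_zeros_of_logConcave_sub_logConvex hu hA hA' hG hG' hApos hGpos hlc hlx h₁ h₃ h12 h23
      (hz x₁ (by simp)) (hz x₂ (by simp)) (hz x₃ (by simp))

end ProductPlusOne

end Summit.ValiantsHypothesis.ValiantsHypothesis.Theorems.LacunarySymmetroidMatrixDescartes
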